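import Literature.AlgebraicGeometry.HodgeTheory.AbelianVarietyPrimeOrderAutomorphismRotationNumberFormula
import HarnessLib

/-!
# The integrality condition `Σ_h 𝐛(h) 𝐣(h⁻¹) ∈ pℤ` on the rotation numbers (Zarhin, Remark 1.14, Corollary 1.15,
# Theorem 2.1 (ii)) — and its necessity under the Lefschetz identity

Family `hodge`, lane `lit-hodgefound` (seat p03, GEN 35 «the analytic type of a finite-order automorphism», row g35-#9; sequel of
g35-#6 `AbelianVarietyPrimeOrderAutomorphismRotationNumberFormula`), topic `Literature/AlgebraicGeometry/HodgeTheory`.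
Theorems only: no definition, no instance, no named fact (net Literature debt 0).

Zarhin's construction (Theorem 2.1) of a Jacobian with prescribed rotation numbers `𝐛 : G = (ℤ/pℤ)^* → ℤ_+` — the
superelliptic curve `y^p = ∏_h f_h(x)^{𝐣(h⁻¹)}`, `deg f_h = 𝐛(h)` — needs, besides `Σ_h 𝐛(h) = 2g/(p−1) + 2`, the
INTEGRALITY CONDITION (ii) `Σ_{h∈G} 𝐛(h) 𝐣(h⁻¹) ∈ pℤ` (so that `deg f ≡ 0 mod p` and `∞` is not a branch point).  Remark 1.14
(`𝐣(vh) ≡ 𝐣(v)𝐣(h) mod p`, with `p ∤ 𝐣(v)`) and Corollary 1.15 show that (ii) is equivalent to the whole family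
`Σ_h 𝐜(h) 𝐣(v/h) ∈ pℤ ∀ v ∈ G`.  Conversely the condition is NECESSARY for rotation numbers bound to an integer-valued `𝐚` by
the Lefschetz identity: g35-#6's `p(𝐚(v)+1) = Σ_u 𝐛(u) 𝐣(u⁻¹(−v))` exhibits every `Σ_u 𝐛(u)𝐣(u⁻¹w)` as a multiple of `p` (§2),
in particular for the analytic type of `δ` with `Φ_p(δ) = 0` (§3).

## Sources, verbatim (held text `paper:arxiv-2109.06794`)

Yu. G. Zarhin, *Jacobians with automorphisms of prime order*, Math. Research Reports (2021) = arXiv:2109.06794: §1 (chunk p0003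
L106–L112) «`𝐣 : G = (ℤ/pℤ)^* → ℤ`, `(j mod p) ↦ j` (`1 ≤ j ≤ p−1`). Clearly, `𝐣(h₁h₂) ≡ 𝐣(h₁)𝐣(h₂) mod p ∀ h₁, h₂ ∈ G`»;
(chunk p0005 L112–L131) «**Remark 1.14.** If `v ∈ G` then there is an integer `k_v` that does not divide `p` [sic: is not
divisible by `p`] and such that `𝐣(vh) − k_v 𝐣(h)` is divisible by `p` for all `h ∈ G`. Indeed, the function `γ : G → (ℤ/pℤ)^*`,
`h = j mod p ↦ 𝐣(h) mod p = j mod p` is a group homomorphism»; (L133–L150) «**Corollary 1.15.** Let `𝐜 : G → ℤ` be an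
integer-valued function. Then the following conditions are equivalent. (i) `Σ_{h∈G} 𝐜(h)𝐣(h⁻¹) ∈ pℤ`. (ii)
`Σ_{h∈G} 𝐜(h)𝐣(v/h) ∈ pℤ ∀ v ∈ G`. Proof. […] `𝐣(v/h) ≡ k_v 𝐣(h⁻¹) mod p` and therefore
`Σ_h 𝐜(h)𝐣(v/h) ≡ k_v Σ_h 𝐜(h)𝐣(h⁻¹) mod p ∀ v ∈ G`»; §2 (chunk p0006 L5–L28) «**Theorem 2.1.** […] Let `𝐛 : G → ℤ_+` be a
non-negative integer-valued function such that (i) `Σ_{h∈G} 𝐛(h) = 2g/(p−1) + 2`. (ii) `𝐛 ∗ 𝐣(1 mod p) = Σ_{h∈G} 𝐛(h)𝐣(h⁻¹) ∈ pℤ`»;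
§1 Prop. 1.11 (chunk p0004 L113–L152), as formalized in g35-#6 `prime_mul_add_one_eq_sum_of_lefschetz`.

## What is proved

Namespace `Literature.AlgebraicGeometry.HodgeTheory.PrimeOrderRotation` (`p` prime, `G = (ZMod p)ˣ`, `𝐣(h) = (h : ZMod p).val`):
* §1 REMARK 1.14 / COROLLARY 1.15: `val_mul_mod_eq` (`𝐣(vh) ≡ 𝐣(v)𝐣(h) mod p`, as `… % p = …`), `intCast_val_mul_sub_dvd`
  (`p ∣ 𝐣(vh) − 𝐣(v)𝐣(h)` in `ℤ`), **`exists_int_val_mul_sub_dvd`** (Remark 1.14 as printed: `∃ k_v, p ∤ k_v ∧ ∀ h, p ∣ 𝐣(vh) − k_v𝐣(h)`),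
  **`sum_mul_val_div_sub_dvd`** (`p ∣ Σ_h 𝐜(h)𝐣(v/h) − 𝐣(v)·Σ_h 𝐜(h)𝐣(h⁻¹)`), **`dvd_sum_mul_val_inv_iff`** (Corollary 1.15:
  `p ∣ Σ_h 𝐜(h)𝐣(h⁻¹) ↔ ∀ v, p ∣ Σ_h 𝐜(h)𝐣(v/h)`).
* §2 NECESSITY UNDER THE LEFSCHETZ IDENTITY (`K` a field of characteristic `0`, `ζ` a primitive `p`-th root, `𝐚, 𝐛 : G → ℕ` with
  `1 − Σ_h 𝐚(h)ζ^{−h} = Σ_u 𝐛(u)/(1 − ζ^u)`): **`dvd_sum_mul_val_inv_mul_of_lefschetz`** (`p ∣ Σ_u 𝐛(u)𝐣(u⁻¹w)` for every `w`),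
  **`dvd_sum_mul_val_inv_of_lefschetz`** (Theorem 2.1 (ii): `p ∣ Σ_u 𝐛(u)𝐣(u⁻¹)`), and Remark 1.12's odd part
  **`prime_mul_sub_eq_of_lefschetz`** (`p·(𝐚(−v) − 𝐚(v)) = Σ_u 𝐛(u)(2𝐣(u⁻¹v) − p)`, `ℚ`-valued `𝐚, 𝐛`).
* §3 (namespace `…HodgeTheory.AbelianVariety`) for `δ : A ⟶ A` with `Φ_p(δ) = 0` and `𝐛 : G → ℕ` with `1 − τ̄ = Σ_u 𝐛(u)/(1 − ζ^u)`:
  **`dvd_sum_rotation_mul_val_inv_of_lefschetz`** (`p ∣ Σ_u 𝐛(u)𝐣(u⁻¹)`: the rotation numbers of a `μ_p`-Jacobian satisfy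
  Theorem 2.1 (ii)).

## References

* [Zarhin2021PrimeOrderJacobians] Yu. G. Zarhin, Math. Research Reports (2021), arXiv:2109.06794, §1 (1.6), Rem. 1.14, Cor. 1.15,
  Prop. 1.11, Rem. 1.12; §2 Thm. 2.1 (ii) (chunks p0003–p0006).
-/

noncomputable section

namespace Literature.AlgebraicGeometry.HodgeTheory

namespace PrimeOrderRotation

/-! ## §1 Remark 1.14 and Corollary 1.15 -/

section Integrality

variable {p : ℕ} [hp : Fact p.Prime]

/-- **(1.6): `𝐣(vh) ≡ 𝐣(v)𝐣(h) mod p`**, as `𝐣(vh) = 𝐣(v)𝐣(h) mod p` in `ℕ` («`𝐣(h₁h₂) ≡ 𝐣(h₁)𝐣(h₂) mod p`»).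
[cite: Zarhin2021PrimeOrderJacobians, §1 (1.6) (chunk p0003 L110–L112)] -/
theorem val_mul_mod_eq (v h : (ZMod p)ˣ) :
    ((v * h : (ZMod p)ˣ) : ZMod p).val = (v : ZMod p).val * (h : ZMod p).val % p := by
  rw [Units.val_mul, ZMod.val_mul]

/-- `p ∣ 𝐣(vh) − 𝐣(v)𝐣(h)` in `ℤ` («`γ(vh) = γ(v)γ(h)`»). [cite: Zarhin2021PrimeOrderJacobians, §1 (1.6), Rem. 1.14 (chunk p0003 L110–L112,
p0005 L112–L131)] -/
theorem intCast_val_mul_sub_dvd (v h : (ZMod p)ˣ) :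
    (p : ℤ) ∣ (((v * h : (ZMod p)ˣ) : ZMod p).val : ℤ) - ((v : ZMod p).val : ℤ) * ((h : ZMod p).val : ℤ) := by
  rw [val_mul_mod_eq, ← Int.natCast_mul, ← ZMod.intCast_eq_intCast_iff_dvd_sub, Int.cast_natCast, Int.cast_natCast,
    ZMod.natCast_mod]

/-- **Remark 1.14 (Zarhin): for `v ∈ G` there is an integer `k_v`, not divisible by `p`, with `p ∣ 𝐣(vh) − k_v 𝐣(h)` for all
`h ∈ G`** — namely `k_v = 𝐣(v)`. [cite: Zarhin2021PrimeOrderJacobians, §1 Rem. 1.14 (chunk p0005 L112–L131)] -/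
theorem exists_int_val_mul_sub_dvd (v : (ZMod p)ˣ) :
    ∃ k : ℤ, ¬ (p : ℤ) ∣ k ∧ ∀ h : (ZMod p)ˣ, (p : ℤ) ∣ (((v * h : (ZMod p)ˣ) : ZMod p).val : ℤ) - k * ((h : ZMod p).val : ℤ) := by
  refine ⟨((v : ZMod p).val : ℤ), fun hdvd ↦ ?_, fun h ↦ intCast_val_mul_sub_dvd v h⟩
  have h1 : p ∣ (v : ZMod p).val := Int.natCast_dvd_natCast.1 hdvd
  have h2 := ZMod.val_lt (v : ZMod p)
  have h3 := val_units_ne_zero v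
  exact h3 (Nat.eq_zero_of_dvd_of_lt h1 h2)

/-- **Corollary 1.15, the congruence: `p ∣ Σ_h 𝐜(h)𝐣(v/h) − 𝐣(v)·Σ_h 𝐜(h)𝐣(h⁻¹)`** for every `𝐜 : G → ℤ` and `v ∈ G`
(«`Σ_h 𝐜(h)𝐣(v/h) ≡ k_v Σ_h 𝐜(h)𝐣(h⁻¹) mod p ∀ v ∈ G`»). [cite: Zarhin2021PrimeOrderJacobians, §1 Cor. 1.15 with proof (chunk p0005 L133–L150)] -/
theorem sum_mul_val_div_sub_dvd (c : (ZMod p)ˣ → ℤ) (v : (ZMod p)ˣ) :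
    (p : ℤ) ∣ ∑ h : (ZMod p)ˣ, c h * (((v * h⁻¹ : (ZMod p)ˣ) : ZMod p).val : ℤ) -
      ((v : ZMod p).val : ℤ) * ∑ h : (ZMod p)ˣ, c h * (((h⁻¹ : (ZMod p)ˣ) : ZMod p).val : ℤ) := by
  rw [Finset.mul_sum, ← Finset.sum_sub_distrib]
  refine Finset.dvd_sum fun h _ ↦ ?_
  have h1 := intCast_val_mul_sub_dvd v h⁻¹
  rw [show c h * (((v * h⁻¹ : (ZMod p)ˣ) : ZMod p).val : ℤ) - ((v : ZMod p).val : ℤ) * (c h * (((h⁻¹ : (ZMod p)ˣ) : ZMod p).val : ℤ))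
      = c h * ((((v * h⁻¹ : (ZMod p)ˣ) : ZMod p).val : ℤ) - ((v : ZMod p).val : ℤ) * (((h⁻¹ : (ZMod p)ˣ) : ZMod p).val : ℤ)) by ring]
  exact Dvd.dvd.mul_left h1 (c h)

/-- **Corollary 1.15 (Zarhin): for `𝐜 : G → ℤ`, `Σ_h 𝐜(h)𝐣(h⁻¹) ∈ pℤ ⟺ Σ_h 𝐜(h)𝐣(v/h) ∈ pℤ` for all `v ∈ G`.**
[cite: Zarhin2021PrimeOrderJacobians, §1 Cor. 1.15 (chunk p0005 L133–L150)] -/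
theorem dvd_sum_mul_val_inv_iff (c : (ZMod p)ˣ → ℤ) :
    (p : ℤ) ∣ ∑ h : (ZMod p)ˣ, c h * (((h⁻¹ : (ZMod p)ˣ) : ZMod p).val : ℤ) ↔
      ∀ v : (ZMod p)ˣ, (p : ℤ) ∣ ∑ h : (ZMod p)ˣ, c h * (((v * h⁻¹ : (ZMod p)ˣ) : ZMod p).val : ℤ) := by
  constructor
  · intro hdvd v
    have h1 := sum_mul_val_div_sub_dvd c v
    have h2 : (p : ℤ) ∣ ((v : ZMod p).val : ℤ) * ∑ h : (ZMod p)ˣ, c h * (((h⁻¹ : (ZMod p)ˣ) : ZMod p).val : ℤ) :=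
      Dvd.dvd.mul_left hdvd _
    have h3 := Dvd.dvd.add h1 h2
    rwa [sub_add_cancel] at h3
  · intro hall
    simpa only [one_mul] using hall 1

end Integrality

/-! ## §2 Under the Lefschetz identity: necessity of Theorem 2.1 (ii), and the odd part of `𝐚` (Remark 1.12) -/

section Necessity

variable {K : Type*} [Field K] [CharZero K] {p : ℕ} [hp : Fact p.Prime] {ζ : K}

/-- **`p ∣ Σ_u 𝐛(u) 𝐣(u⁻¹ w)` for every `w ∈ G`** whenever `𝐚, 𝐛 : G → ℤ_+` are bound by the Lefschetz identity — g35-#6's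
`p(𝐚(−w) + 1) = Σ_u 𝐛(u)𝐣(u⁻¹ w)` (condition (ii) of Corollary 1.15 for `𝐜 = 𝐛`, since `𝐣(u⁻¹w) = 𝐣(w/u)`).
[cite: Zarhin2021PrimeOrderJacobians, §1 Prop. 1.11, Cor. 1.15 (ii) (chunk p0004 L113–L152, p0005 L133–L140)] -/
theorem dvd_sum_mul_val_inv_mul_of_lefschetz (hζ : IsPrimitiveRoot ζ p) (a b : (ZMod p)ˣ → ℕ)
    (hL : 1 - ∑ h : (ZMod p)ˣ, (a h : K) * ζ ^ ((-h : (ZMod p)ˣ) : ZMod p).val =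
      ∑ u : (ZMod p)ˣ, (b u : K) / (1 - ζ ^ (u : ZMod p).val)) (w : (ZMod p)ˣ) :
    p ∣ ∑ u : (ZMod p)ˣ, b u * ((u⁻¹ * w : (ZMod p)ˣ) : ZMod p).val := by
  have h := prime_mul_add_one_eq_sum_of_lefschetz_nat hζ a b hL (-w)
  rw [neg_neg] at h
  exact Dvd.intro _ h

/-- **Theorem 2.1 (ii) is necessary: `Σ_{h∈G} 𝐛(h)𝐣(h⁻¹) ∈ pℤ`** for any `𝐛 : G → ℤ_+` bound to some `𝐚 : G → ℤ_+` by the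
Lefschetz identity («(ii) `𝐛 ∗ 𝐣(1 mod p) = Σ_{h∈G} 𝐛(h)𝐣(h⁻¹) ∈ pℤ`»). [cite: Zarhin2021PrimeOrderJacobians, §2 Thm. 2.1 (ii)
(chunk p0006 L19–L28), §1 Prop. 1.11 (chunk p0004 L113–L152)] -/
theorem dvd_sum_mul_val_inv_of_lefschetz (hζ : IsPrimitiveRoot ζ p) (a b : (ZMod p)ˣ → ℕ)
    (hL : 1 - ∑ h : (ZMod p)ˣ, (a h : K) * ζ ^ ((-h : (ZMod p)ˣ) : ZMod p).val =
      ∑ u : (ZMod p)ˣ, (b u : K) / (1 - ζ ^ (u : ZMod p).val)) :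
    p ∣ ∑ u : (ZMod p)ˣ, b u * ((u⁻¹ : (ZMod p)ˣ) : ZMod p).val := by
  simpa only [mul_one] using dvd_sum_mul_val_inv_mul_of_lefschetz hζ a b hL 1

/-- **Remark 1.12 (the odd part): `p·(𝐚(−v) − 𝐚(v)) = Σ_{u∈G} 𝐛(u)·(2𝐣(u⁻¹v) − p)`**, i.e. with Zarhin's odd function
`𝐣₀ = 𝐣 − p/2` («`𝐣₀(−u) = −𝐣₀(u)`»): `𝐚(−v) − 𝐚(v) = (2/p) Σ_u 𝐛(u) 𝐣₀(u⁻¹v)` — the odd part of `𝐚` is the `𝐣₀`-convolution of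
`𝐛` («`𝐚(v) = ((p−1)/p)·𝐛 ∗ 𝐣₀(−v) + g/(p−1)`», from `𝐛 ∗ 𝐣 = 𝐛 ∗ 𝐣₀ + (p/(2(p−1))) Σ_h 𝐛(h)`), for any `𝐚, 𝐛 : G → ℚ` bound by
the Lefschetz identity. [cite: Zarhin2021PrimeOrderJacobians, §1 Rem. 1.12 (1.13)–(1.14) (chunk p0004 L154–L160, p0005 L1–L12)] -/
theorem prime_mul_sub_eq_of_lefschetz (hζ : IsPrimitiveRoot ζ p) (a b : (ZMod p)ˣ → ℚ)
    (hL : 1 - ∑ h : (ZMod p)ˣ, (a h : K) * ζ ^ ((-h : (ZMod p)ˣ) : ZMod p).val =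
      ∑ u : (ZMod p)ˣ, (b u : K) / (1 - ζ ^ (u : ZMod p).val)) (v : (ZMod p)ˣ) :
    (p : ℚ) * (a (-v) - a v) = ∑ u : (ZMod p)ˣ, b u * (2 * (((u⁻¹ * v : (ZMod p)ˣ) : ZMod p).val : ℚ) - p) := by
  have h1 := prime_mul_add_one_eq_sum_of_lefschetz hζ a b hL v
  have h2 := prime_mul_add_one_eq_sum_of_lefschetz hζ a b hL (-v)
  have hsum : ∑ u : (ZMod p)ˣ, b u * (((u⁻¹ * -v : (ZMod p)ˣ) : ZMod p).val : ℚ) +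
      ∑ u : (ZMod p)ˣ, b u * (((u⁻¹ * - -v : (ZMod p)ˣ) : ZMod p).val : ℚ) = p * ∑ u : (ZMod p)ˣ, b u := by
    rw [← Finset.sum_add_distrib, Finset.mul_sum]
    refine Finset.sum_congr rfl fun u _ ↦ ?_
    rw [neg_neg, ← mul_add, ← Nat.cast_add, mul_neg, add_comm, val_add_val_neg, mul_comm]
  have hR : ∑ u : (ZMod p)ˣ, b u * (2 * (((u⁻¹ * v : (ZMod p)ˣ) : ZMod p).val : ℚ) - p) =
      2 * ∑ u : (ZMod p)ˣ, b u * (((u⁻¹ * - -v : (ZMod p)ˣ) : ZMod p).val : ℚ) - p * ∑ u : (ZMod p)ˣ, b u := by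
    rw [neg_neg, Finset.mul_sum, Finset.mul_sum, ← Finset.sum_sub_distrib]
    exact Finset.sum_congr rfl fun u _ ↦ by ring
  rw [hR]
  linear_combination h2 - h1 - hsum

end Necessity

end PrimeOrderRotation

/-! ## §3 The rotation numbers of `δ` with `Φ_p(δ) = 0` satisfy Theorem 2.1 (ii) -/

namespace AbelianVariety

open CategoryTheory Polynomial PrimeOrderRotation

section Integrality

variable {A : Motives.AbelianVariety ℂ} {δ : A ⟶ A} {p : ℕ} [hp : Fact p.Prime] {ζ : ℂ}

/-- **`p ∣ Σ_{u∈G} 𝐛(u)𝐣(u⁻¹w)` for all `w`, in particular `Σ_u 𝐛(u)𝐣(u⁻¹) ∈ pℤ` (Theorem 2.1 (ii)),** for every `𝐛 : G → ℕ`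
satisfying the Lefschetz identity `1 − τ̄ = Σ_u 𝐛(u)/(1 − ζ^u)` with `τ = Tr_a(δ)`, `Φ_p(δ) = 0`: the rotation numbers of a
Jacobian automorphism of prime order are integral in Zarhin's sense. [cite: Zarhin2021PrimeOrderJacobians, §2 Thm. 2.1 (ii)
(chunk p0006 L19–L28), §1 Prop. 1.11, Cor. 1.15 (chunk p0004 L113–L152, p0005 L133–L150)] -/
theorem dvd_sum_rotation_mul_val_inv_of_lefschetz
    (hδ : (cyclotomic p ℤ).eval₂ (Int.castRingHom (End A)) (End.of δ) = 0) (hζ : IsPrimitiveRoot ζ p)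
    (b : (ZMod p)ˣ → ℕ)
    (hL : 1 - starRingEnd ℂ (LinearMap.trace ℂ (Motives.AbelianVariety.Lie A) (Motives.AbelianVariety.lieMap A δ)) =
      ∑ u : (ZMod p)ˣ, (b u : ℂ) / (1 - ζ ^ (u : ZMod p).val)) :
    (∀ w : (ZMod p)ˣ, p ∣ ∑ u : (ZMod p)ˣ, b u * ((u⁻¹ * w : (ZMod p)ˣ) : ZMod p).val) ∧
      p ∣ ∑ u : (ZMod p)ˣ, b u * ((u⁻¹ : (ZMod p)ˣ) : ZMod p).val := by
  rw [conj_trace_lieMap_eq_sum_units hδ hζ] at hL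
  exact ⟨dvd_sum_mul_val_inv_mul_of_lefschetz hζ _ b hL, dvd_sum_mul_val_inv_of_lefschetz hζ _ b hL⟩

end Integrality

end AbelianVariety

end Literature.AlgebraicGeometry.HodgeTheory

end
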